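import Mathlib.NumberTheory.Padics.Complex
import Literature.NumberTheory.EllipticCurves.DeligneSerreProp27LevelDescentProofs
import Literature.NumberTheory.EllipticCurves.DeligneSerreProp27Proofs
import Literature.NumberTheory.EllipticCurves.HeckeOperatorsDiamondProofs
import Literature.NumberTheory.GaloisRepresentations.AbsolutelyIrreducibleReduction
import Literature.NumberTheory.GaloisRepresentations.TeichmullerCharacter
import Literature.RingTheory.Valuation.DeligneSerreLiftAlgClosed
import HarnessLib

/-!
# Deligne–Serre lifting for cusp forms on `Γ₁(N)` of a fixed nebentypus, read through
# `ι : ℚ̄_p ≃ ℂ` (proofs only)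

Topic `Literature/NumberTheory/EllipticCurves`; namespace
`Literature.NumberTheory.EllipticCurves.ModularForms`.  THEOREMS ONLY (no definition, no named
fact; D-0026).  A proofs-only companion of the named facts
`Literature.NumberTheory.EllipticCurves.BillereyMenares2016_thm22_exists_newform(_odd)` and
`Literature.NumberTheory.EllipticCurves.BillereyMenares2018_exists_newform`
(`EisensteinNewformLevelRaising.lean`), formalising the step of their printed proofs at which
Deligne–Serre's lifting lemma is invoked: N. Billerey, R. Menares, *On the modularity of
reducible mod `l` Galois representations*, Math. Res. Lett. 23 (2016), §2, proof of Thm. 2.2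
(p. 7): "the reduction `F` of `E` modulo `λ` is a cuspidal eigenform with coefficients in `𝔽̄_l`
and eigenvalues `1 + ε(q)q^{k-1}` for every prime `q ∤ Np`.  According to [DeSe74] we can find a
form `f ∈ S_k(Γ₀(Np), ε₀)` which is an eigenform for the Hecke operators `{T_q}_{q ∤ Np}` with
corresponding eigenvalues `{a_q}` satisfying `a_q ≡ 1 + ε(q)q^{k-1} (mod 𝓛)` for some prime
ideal `𝓛` over `λ`"; Deligne–Serre, *Formes modulaires de poids 1*, Ann. Sci. ÉNS (4) 7 (1974),
6.10 and Lemme 6.11, applied "aux `T_p` agissant sur le `𝒪_λ`-module `M` des formes modulaires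
de type `(k, ε)` sur `Γ₀(N)`, à coefficients dans `𝒪_λ`".

## The statement (`exists_eigenform_of_congruence`)

Fix a prime `p`, a field isomorphism `ι : ℚ̄_p ≃ ℂ` (so that "`x ≡ y` modulo the maximal ideal
`𝔪` of `𝒪_{ℚ̄_p}`" reads `‖ι⁻¹ x - ι⁻¹ y‖ < 1`), a level `N ≥ 1`, a weight `k ≥ 1`, a
Dirichlet character `χ₀` modulo `N` **of order prime to `p`** (the Teichmüller nebentypus of the
applications), and a cusp form `f₀ ∈ S_k(N, χ₀)` whose Fourier coefficients are `p`-integral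
through `ι⁻¹` and not all in `𝔪`.  Let `𝒯` be a family of pairwise commuting endomorphisms of
`S_k(Γ₁(N))` commuting with the diamond operators and preserving Deligne–Serre's lattice `L` of
forms with integral Fourier coefficients (e.g. the Hecke operators `T_q`, all primes `q`), with
`p`-integral targets `a_T ∈ ℚ̄_p` such that `f₀` is an eigenvector of every `T ∈ 𝒯` MODULO `𝔪`:
`ι⁻¹ aₙ(T f₀) ≡ a_T · ι⁻¹ aₙ(f₀)` for all `n`.  THEN there is a genuine non-zero common eigenform
`g ∈ S_k(N, χ₀)` — same weight, same level, same nebentypus — with `T g = ι(a'_T) g`,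
`‖a'_T‖ ≤ 1` and `‖a'_T - a_T‖ < 1` for all `T ∈ 𝒯`.

Without the hypothesis `p ∤ m` (`exists_eigenform_of_congruence_nebentypus_congr`, the general
form, from which the above is derived): the same, except that the lift `g` is only asserted to be an
eigenvector of every `⟨d⟩` with eigenvalue an `m`-th root of unity CONGRUENT to `χ₀(d)` — i.e. `g`
has a nebentypus `ψ ≡ χ₀ (mod 𝔪)` — which is all that steps `(α)`–`(γ)` give; `p ∤ m` is used only
in the last line of `(δ)` (`ψ = χ₀`).  The general form is the one available at `p = 2` in odd
weight, where every nebentypus has even order.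

## The proof

Everything is assembled from the tree:

* (2.7.1)–(2.7.2): `L = integralLattice1 N k` is a finitely generated lattice spanning
  `S_k(Γ₁(N))`, stable under `𝒯` and the `⟨d⟩`, and a `ℤ`-basis of `L` is a `ℂ`-basis
  (`DeligneSerre1974_span_integralLattice1_holds`, `LatticeEigen`, `integralBasis`).
* `(α)` **coefficients control coordinates.**  The matrix of twisted coefficient functionals
  `x ↦ aₙ(⟨d⟩ x)` on a `ℤ`-basis of `L` has a square integer submatrix with determinant prime to
  `p` — because `L` is, by its very definition, `p`-saturated in the module of `q`-expansions
  (`x ∈ L`, all `aₙ(⟨d⟩ x) ∈ pℤ` ⇒ `x ∈ pL`), so that the rows span `𝔽_pⁿ` modulo `p` — and the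
  adjugate formula bounds the `p`-adic size of the coordinates of any `x ∈ S_k(Γ₁(N))` by that of
  its twisted coefficients (`exists_det_not_dvd`, `norm_repr_le`, `norm_repr_lt`).
* `(β)` **the type.**  Let `m` be the order of `χ₀` (`p ∤ m`) and `W` the fixed space of the
  operators `⟨d^m⟩`; it contains `S_k(N, χ₀)`, is stable under `𝒯`, and is cut out over `ℤ`
  (`∑_d ⟨d^m⟩` maps `L` into `L ∩ W` and acts on `W` as `φ(N)`), so `L ∩ W` is a saturated
  sublattice spanning `W` and a direct summand of `L` (`ℤ` is a PID): there is a `ℤ`-basis of `L`,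
  hence a `ℂ`-basis of `S_k(Γ₁(N))`, whose first vectors form a basis of `W`
  (`exists_adapted_basis`).
* `(γ)` **Lemme 6.11.**  In that basis the operators of `𝒯` and the `⟨d⟩` act on `W` by
  commuting integer matrices; `f₀ ∈ W` has `𝒪_{ℚ̄_p}`-integral coordinates, one of them a unit,
  and is an eigenvector modulo `𝔪`.  The tree's Deligne–Serre lemma over the valuation ring
  `𝒪_{ℚ̄_p}` of the ALGEBRAICALLY CLOSED field `ℚ̄_p`
  (`Literature.RingTheory.Valuation.exists_eigenvalue_lift_of_isAlgClosed`) lifts the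
  eigenvalues into `𝒪_{ℚ̄_p}` itself — no extension of scalars, so the congruences stay in THE
  maximal ideal read by `ι` — with a common eigenvector, transported back to `S_k(Γ₁(N))` by `ι`.
* `(δ)` **the nebentypus of the lift.**  Its `⟨d⟩`-eigenvalue is an `m`-th root of unity
  (it lies in `W`) congruent to the `m`-th root of unity `χ₀(d)`; as `p ∤ m`, they are equal
  (`Literature.NumberTheory.GaloisRepresentations.eq_of_pow_eq_one_of_norm_sub_lt_one` of
  `TeichmullerCharacter.lean`), so the lift lies in `S_k(N, χ₀)`.

## References

* P. Deligne, J.-P. Serre, *Formes modulaires de poids 1*, Ann. Sci. ÉNS (4) 7 (1974), 507–530,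
  Prop. 2.7, 6.10, Lemme 6.11. [DeligneSerreASENS1974]
* N. Billerey, R. Menares, *On the modularity of reducible mod `l` Galois representations*, Math.
  Res. Lett. 23 (2016), 15–41, §2, proof of Thm. 2.2 (p. 7). [BillereyMenares2016]
* N. Billerey, R. Menares, *Strong modularity of reducible Galois representations*, Trans. AMS
  370 (2018), §3.2. [BillereyMenares2018]
-/

noncomputable section

open scoped MatrixGroups ModularForm
open CongruenceSubgroup Module IsLocalRing

namespace Literature.NumberTheory.EllipticCurves.ModularForms

namespace DeligneSerreLift

/-! ### `(0)` Integers and roots of unity in `ℚ̄_p` -/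

section Padic

variable {p : ℕ} [Fact p.Prime]

/-- Integers have norm `≤ 1` in `ℚ̄_p`. [folklore] -/
theorem norm_intCast_le_one (z : ℤ) : ‖(z : PadicAlgCl p)‖ ≤ 1 := by
  rw [← map_intCast (algebraMap ℚ_[p] (PadicAlgCl p)) z]
  change ‖((z : ℚ_[p]) : PadicAlgCl p)‖ ≤ 1
  rw [PadicAlgCl.norm_extends]
  exact Padic.norm_int_le_one z

/-- An integer prime to `p` has norm `1` in `ℚ̄_p`. [folklore] -/
theorem norm_intCast_eq_one_of_not_dvd {z : ℤ} (hz : ¬ (p : ℤ) ∣ z) :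
    ‖(z : PadicAlgCl p)‖ = 1 := by
  rw [← map_intCast (algebraMap ℚ_[p] (PadicAlgCl p)) z]
  change ‖((z : ℚ_[p]) : PadicAlgCl p)‖ = 1
  rw [PadicAlgCl.norm_extends]
  exact le_antisymm (Padic.norm_int_le_one z)
    (not_lt.1 fun h ↦ hz (Padic.norm_intCast_lt_one_iff.1 h))

end Padic

/-! ### `(α)` Coefficients control coordinates -/

section Coordinates

variable {p : ℕ} [Fact p.Prime] {N : ℕ} [NeZero N] {k : ℤ}

omit [NeZero N] in
/-- `aₙ` is additive over finite sums (the functional `cuspCoeffₗ`). [folklore] -/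
theorem cuspCoeff_sum_gamma1 {ι : Type*} (s : Finset ι) (F : ι → CuspForm (Gamma1 N) k) (n : ℕ) :
    cuspCoeff (∑ i ∈ s, F i) n = ∑ i ∈ s, cuspCoeff (F i) n := by
  have h := map_sum (cuspCoeffₗ (k := k) (HeckeTGamma1.one_mem_strictPeriods_Gamma1 N) n) F s
  simpa only [cuspCoeffₗ_apply] using h

/-- **`L` is `p`-saturated** (by its definition): if `x ∈ L = integralLattice1 N k` has all its
twisted coefficients `aₙ(⟨d⟩ x)` in `pℤ`, then `x ∈ pL`.
[cite: DeligneSerreASENS1974, Prop. 2.7 (definition of `L`)] -/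
theorem exists_eq_prime_smul_of_forall_dvd {x : CuspForm (Gamma1 N) k}
    (h : ∀ (d : (ZMod N)ˣ) (n : ℕ), ∃ z : ℤ,
      (p : ℂ) * z = cuspCoeff (diamondOp N k (d : ZMod N) x) n) :
    ∃ y ∈ integralLattice1 N k, x = (p : ℂ) • y := by
  have hp0 : (p : ℂ) ≠ 0 := Nat.cast_ne_zero.mpr (Fact.out : p.Prime).ne_zero
  refine ⟨(p : ℂ)⁻¹ • x, ?_, by rw [smul_smul, mul_inv_cancel₀ hp0, one_smul]⟩
  rw [mem_integralLattice1]
  intro d n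
  obtain ⟨z, hz⟩ := h d n
  refine ⟨z, ?_⟩
  rw [map_smul, cuspCoeff_smul_gamma1, ← hz, ← mul_assoc, inv_mul_cancel₀ hp0, one_mul]

variable {J : Type*} [Fintype J] [DecidableEq J]

/-- **A square system of twisted coefficient functionals with determinant prime to `p`.**  For a
`ℂ`-basis `B` of `S_k(Γ₁(N))` made of vectors of `L` in which every element of `L` has integer
coordinates (e.g. a `ℤ`-basis of `L`, (2.7.2)), there are indices `(dᵢ, nᵢ)` and the integer
matrix `A i j = a_{nᵢ}(⟨dᵢ⟩ B j)` with `p ∤ det A` — the rows of the full twisted coefficient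
matrix span `𝔽_pᴶ` modulo `p`, because `L` is `p`-saturated (`exists_eq_prime_smul_of_forall_dvd`).
[cite: DeligneSerreASENS1974, Prop. 2.7] -/
theorem exists_det_not_dvd (p : ℕ) [Fact p.Prime] (B : Basis J ℂ (CuspForm (Gamma1 N) k))
    (hBΛ : ∀ j, B j ∈ integralLattice1 N k)
    (hBint : ∀ x ∈ integralLattice1 N k, ∀ j, ∃ n : ℤ, B.repr x j = n) :
    ∃ (s : J → (ZMod N)ˣ × ℕ) (A : Matrix J J ℤ),
      (∀ i j, (A i j : ℂ) = cuspCoeff (diamondOp N k ((s i).1 : ZMod N) (B j)) (s i).2) ∧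
      ¬ (p : ℤ) ∣ A.det := by
  classical
  have hint : ∀ (d : (ZMod N)ˣ) (n : ℕ) (j : J), ∃ z : ℤ,
      (z : ℂ) = cuspCoeff (diamondOp N k (d : ZMod N) (B j)) n :=
    fun d n j ↦ (mem_integralLattice1.mp (hBΛ j)) d n
  choose A0 hA0 using hint
  -- the rows modulo `p`
  let R : (ZMod N)ˣ × ℕ → (J → ZMod p) := fun dn j ↦ (A0 dn.1 dn.2 j : ZMod p)
  have hspan : Submodule.span (ZMod p) (Set.range R) = ⊤ := by
    by_contra hne
    obtain ⟨f, hf0, hle⟩ :=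
      Submodule.exists_le_ker_of_lt_top _ (lt_top_iff_ne_top.mpr hne)
    set cb : J → ZMod p := fun j ↦ f (fun i ↦ if j = i then 1 else 0) with hcb
    have hf : ∀ v : J → ZMod p, f v = ∑ j, v j * cb j := fun v ↦ by
      rw [LinearMap.pi_apply_eq_sum_univ]; rfl
    -- integer lift of `cb`
    let c : J → ℤ := fun j ↦ ((cb j).val : ℤ)
    have hc : ∀ j, (c j : ZMod p) = cb j := fun j ↦ by
      simp only [c, Int.cast_natCast, ZMod.natCast_zmod_val]
    let x : CuspForm (Gamma1 N) k := ∑ j, (c j : ℂ) • B j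
    -- all twisted coefficients of `x` are divisible by `p`
    have hcoef : ∀ (d : (ZMod N)ˣ) (n : ℕ), ∃ z : ℤ,
        (p : ℂ) * z = cuspCoeff (diamondOp N k (d : ZMod N) x) n := by
      intro d n
      have h1 : cuspCoeff (diamondOp N k (d : ZMod N) x) n = ∑ j, (c j : ℂ) * (A0 d n j : ℂ) := by
        simp only [x, map_sum, map_smul, cuspCoeff_sum_gamma1, cuspCoeff_smul_gamma1, hA0]
      have h2 : ((∑ j, c j * A0 d n j : ℤ) : ZMod p) = 0 := by
        have hmem : R (d, n) ∈ LinearMap.ker f :=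
          hle (Submodule.subset_span ⟨(d, n), rfl⟩)
        rw [LinearMap.mem_ker, hf] at hmem
        push_cast
        rw [← hmem]
        refine Finset.sum_congr rfl fun j _ ↦ ?_
        rw [hc, mul_comm]
      obtain ⟨z, hz⟩ := (ZMod.intCast_zmod_eq_zero_iff_dvd _ p).mp h2
      refine ⟨z, ?_⟩
      rw [h1]
      have : ((∑ j, c j * A0 d n j : ℤ) : ℂ) = (p : ℂ) * z := by
        rw [hz]; push_cast; ring
      rw [← this]; push_cast; rfl
    obtain ⟨y, hyΛ, hxy⟩ := exists_eq_prime_smul_of_forall_dvd hcoef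
    -- hence the coordinates `c j` are divisible by `p`, i.e. `cb = 0`
    have hcb0 : ∀ j, cb j = 0 := by
      intro j
      obtain ⟨n, hn⟩ := hBint y hyΛ j
      have hrepr : (c j : ℂ) = (p : ℂ) * n := by
        have h1 : B.repr x j = c j := congrFun (B.repr_sum_self (fun j ↦ (c j : ℂ))) j
        rw [← h1, hxy, map_smul, Finsupp.smul_apply, smul_eq_mul, hn]
      have hcj : c j = p * n := by exact_mod_cast hrepr
      rw [← hc, hcj]; push_cast; simp
    apply hf0
    refine LinearMap.ext fun v ↦ ?_
    rw [hf]
    simp [hcb0]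
  -- extract a basis of `𝔽_pᴶ` among the rows
  obtain ⟨t, ht, hspan_t, hli⟩ := exists_linearIndependent (ZMod p) (Set.range R)
  rw [hspan] at hspan_t
  haveI : Finite t := hli.finite
  letI : Fintype t := Fintype.ofFinite t
  have hcard : Fintype.card t = Fintype.card J := by
    have h1 : Module.finrank (ZMod p) (Submodule.span (ZMod p) t) = t.toFinset.card :=
      finrank_span_set_eq_card (R := ZMod p) hli
    rw [hspan_t, finrank_top, Module.finrank_fintype_fun_eq_card] at h1
    rw [h1, Set.toFinset_card]
  let e : J ≃ t := (Fintype.equivOfCardEq hcard).symm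
  let Mt : Matrix J J (ZMod p) := Matrix.of fun i j ↦ ((e i : t) : J → ZMod p) j
  have hrows : LinearIndependent (ZMod p) Mt.row := by
    have : Mt.row = (fun x : t ↦ (x : J → ZMod p)) ∘ e := by
      ext i j; rfl
    rw [this]
    exact hli.comp _ e.injective
  have hunit : IsUnit Mt := Matrix.linearIndependent_rows_iff_isUnit.mp hrows
  have hs : ∀ i, ∃ dn, R dn = ((e i : t) : J → ZMod p) := fun i ↦ ht (e i).2
  choose s hs using hs
  refine ⟨s, Matrix.of fun i j ↦ A0 (s i).1 (s i).2 j, fun i j ↦ hA0 _ _ _, fun hdvd ↦ ?_⟩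
  have hmap : (Matrix.of fun i j ↦ A0 (s i).1 (s i).2 j).map (Int.castRingHom (ZMod p)) = Mt := by
    ext i j
    simp only [Matrix.map_apply, Matrix.of_apply, eq_intCast, Mt]
    rw [← hs i]
  have hdet : Mt.det = (((Matrix.of fun i j ↦ A0 (s i).1 (s i).2 j).det : ℤ) : ZMod p) := by
    rw [← hmap, ← RingHom.mapMatrix_apply, ← RingHom.map_det, eq_intCast]
  have h0 : Mt.det = 0 := by
    rw [hdet, (ZMod.intCast_zmod_eq_zero_iff_dvd _ p).mpr hdvd]
  exact ((Matrix.isUnit_iff_isUnit_det _).mp hunit).ne_zero h0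

/-- **Coordinates are bounded by finitely many twisted coefficients** (adjugate formula): for a
basis `B` as in `exists_det_not_dvd` there are finitely many indices `(dᵢ, nᵢ)` such that for every
`x ∈ S_k(Γ₁(N))` and `r ≥ 0`, if `‖ι⁻¹ a_{nᵢ}(⟨dᵢ⟩ x)‖ ≤ r` for all `i` then every coordinate of
`x` in `B` has `‖ι⁻¹ ·‖ ≤ r`. [cite: DeligneSerreASENS1974, Prop. 2.7] -/
theorem exists_forall_norm_repr_le (ι : PadicAlgCl p ≃+* ℂ) (B : Basis J ℂ (CuspForm (Gamma1 N) k))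
    (hBΛ : ∀ j, B j ∈ integralLattice1 N k)
    (hBint : ∀ x ∈ integralLattice1 N k, ∀ j, ∃ n : ℤ, B.repr x j = n) :
    ∃ s : J → (ZMod N)ˣ × ℕ, ∀ (x : CuspForm (Gamma1 N) k) (r : ℝ), 0 ≤ r →
      (∀ i, ‖ι.symm (cuspCoeff (diamondOp N k ((s i).1 : ZMod N) x) (s i).2)‖ ≤ r) →
      ∀ j, ‖ι.symm (B.repr x j)‖ ≤ r := by
  classical
  obtain ⟨s, A, hA, hdet⟩ := exists_det_not_dvd p B hBΛ hBint
  refine ⟨s, fun x r hr h j ↦ ?_⟩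
  -- `A c = Φ`
  set c : J → ℂ := fun j ↦ B.repr x j with hc
  set Φ : J → ℂ := fun i ↦ cuspCoeff (diamondOp N k ((s i).1 : ZMod N) x) (s i).2 with hΦ
  set A' : Matrix J J ℂ := A.map (Int.castRingHom ℂ) with hA'
  have hAc : A'.mulVec c = Φ := by
    ext i
    simp only [Matrix.mulVec, dotProduct, hA', Matrix.map_apply, eq_intCast, hA, hΦ, hc]
    conv_rhs => rw [← B.sum_repr x]
    rw [map_sum, cuspCoeff_sum_gamma1]
    refine Finset.sum_congr rfl fun j _ ↦ ?_
    rw [map_smul, cuspCoeff_smul_gamma1, mul_comm]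
  -- `det A • c = adj A Φ`
  have hadj : (A.det : ℂ) • c = (A'.adjugate).mulVec Φ := by
    rw [← hAc, Matrix.mulVec_mulVec, Matrix.adjugate_mul, Matrix.smul_mulVec,
      Matrix.one_mulVec]
    congr 1
    rw [hA', ← RingHom.mapMatrix_apply, ← RingHom.map_det, eq_intCast]
  have hadjint : ∀ i j, A'.adjugate i j = ((A.adjugate i j : ℤ) : ℂ) := by
    intro i j
    rw [hA', ← RingHom.mapMatrix_apply, ← RingHom.map_adjugate, RingHom.mapMatrix_apply,
      Matrix.map_apply, eq_intCast]
  have hj : (A.det : ℂ) * c j = ∑ i, ((A.adjugate j i : ℤ) : ℂ) * Φ i := by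
    have := congrFun hadj j
    simp only [Pi.smul_apply, smul_eq_mul, Matrix.mulVec, dotProduct, hadjint] at this
    exact this
  -- apply `ι⁻¹` and take norms
  have hj' : (A.det : PadicAlgCl p) * ι.symm (c j) =
      ∑ i, ((A.adjugate j i : ℤ) : PadicAlgCl p) * ι.symm (Φ i) := by
    have := congrArg ι.symm hj
    simpa [map_mul, map_sum, map_intCast] using this
  have hnorm : ‖(A.det : PadicAlgCl p) * ι.symm (c j)‖ ≤ r := by
    rw [hj']
    refine IsUltrametricDist.norm_sum_le_of_forall_le_of_nonneg hr fun i _ ↦ ?_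
    rw [norm_mul]
    calc ‖((A.adjugate j i : ℤ) : PadicAlgCl p)‖ * ‖ι.symm (Φ i)‖ ≤ 1 * r := by
          gcongr
          · exact norm_intCast_le_one _
          · exact h i
      _ = r := one_mul r
  rwa [norm_mul, norm_intCast_eq_one_of_not_dvd hdet, one_mul] at hnorm

/-- **Coordinates are bounded by twisted coefficients**: if all `‖ι⁻¹ aₙ(⟨d⟩ x)‖ ≤ r` then every
coordinate of `x` in `B` has `‖ι⁻¹ ·‖ ≤ r`. [cite: DeligneSerreASENS1974, Prop. 2.7] -/
theorem norm_repr_le (ι : PadicAlgCl p ≃+* ℂ) (B : Basis J ℂ (CuspForm (Gamma1 N) k))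
    (hBΛ : ∀ j, B j ∈ integralLattice1 N k)
    (hBint : ∀ x ∈ integralLattice1 N k, ∀ j, ∃ n : ℤ, B.repr x j = n)
    (x : CuspForm (Gamma1 N) k) {r : ℝ} (hr : 0 ≤ r)
    (h : ∀ (d : (ZMod N)ˣ) (n : ℕ), ‖ι.symm (cuspCoeff (diamondOp N k (d : ZMod N) x) n)‖ ≤ r)
    (j : J) : ‖ι.symm (B.repr x j)‖ ≤ r := by
  obtain ⟨s, hs⟩ := exists_forall_norm_repr_le ι B hBΛ hBint
  exact hs x r hr (fun i ↦ h _ _) j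

/-- Strict version of `norm_repr_le`: if all `‖ι⁻¹ aₙ(⟨d⟩ x)‖ < r` then every coordinate of `x`
has `‖ι⁻¹ ·‖ < r`. [cite: DeligneSerreASENS1974, Prop. 2.7] -/
theorem norm_repr_lt (ι : PadicAlgCl p ≃+* ℂ) (B : Basis J ℂ (CuspForm (Gamma1 N) k))
    (hBΛ : ∀ j, B j ∈ integralLattice1 N k)
    (hBint : ∀ x ∈ integralLattice1 N k, ∀ j, ∃ n : ℤ, B.repr x j = n)
    (x : CuspForm (Gamma1 N) k) {r : ℝ}
    (h : ∀ (d : (ZMod N)ˣ) (n : ℕ), ‖ι.symm (cuspCoeff (diamondOp N k (d : ZMod N) x) n)‖ < r)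
    (j : J) : ‖ι.symm (B.repr x j)‖ < r := by
  classical
  obtain ⟨s, hs⟩ := exists_forall_norm_repr_le ι B hBΛ hBint
  -- the finitely many relevant coefficients have a maximum `r' < r`
  have hne : (Finset.univ : Finset J).Nonempty := ⟨j, Finset.mem_univ j⟩
  let F : J → ℝ := fun i ↦ ‖ι.symm (cuspCoeff (diamondOp N k ((s i).1 : ZMod N) x) (s i).2)‖
  have hr' : Finset.univ.sup' hne F < r := (Finset.sup'_lt_iff hne).mpr fun i _ ↦ h _ _
  have h0 : 0 ≤ Finset.univ.sup' hne F := (norm_nonneg _).trans (Finset.le_sup' F (Finset.mem_univ j))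
  exact (hs x _ h0 (fun i ↦ Finset.le_sup' F (Finset.mem_univ i)) j).trans_lt hr'

end Coordinates

/-! ### `(β)` A basis of `S_k(Γ₁(N))` adapted to `L` and to a subspace cut out over `ℤ` -/

section Adapted

variable {N : ℕ} [NeZero N] {k : ℤ}

/-- **Adapted basis.**  Let `W ⊆ S_k(Γ₁(N))` (`k ≥ 1`) be a subspace *cut out over `ℤ`*: there is
an endomorphism `E` of `S_k(Γ₁(N))` preserving Deligne–Serre's lattice `L`, with values in `W`,
acting on `W` as a non-zero scalar (e.g. `W` the fixed space of a finite group of diamond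
operators, `E` the sum of its elements).  Then there is a `ℂ`-basis `B` of `S_k(Γ₁(N))` indexed by
`J₁ ⊕ J₂`, made of vectors of `L`, in which the elements of `L` have integer coordinates, whose
`J₁`-part lies in `W` and such that the elements of `W` have vanishing `J₂`-coordinates (so the
`J₁`-part is a basis of `W`).  Proof: `L ∩ W` is a saturated sublattice of the free `ℤ`-module `L`
((2.7.1)), so `L/(L ∩ W)` is free and `L = (L ∩ W) ⊕ C`; a `ℤ`-basis of `L` adapted to this
decomposition is a `ℂ`-basis of `S_k(Γ₁(N))` ((2.7.2), `DeligneSerre1974_span_integralLattice1_holds`,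
and `LatticeEigen.linearIndependent_complex_of_rat_functionals`), and `W = ℂ · (L ∩ W)` because
`w = c⁻¹ E w` with `E w ∈ E(ℂ L) ⊆ ℂ (L ∩ W)`.
[cite: DeligneSerreASENS1974, Prop. 2.7 (2.7.1)–(2.7.2)] -/
theorem exists_adapted_basis (hk : 1 ≤ k) (W : Submodule ℂ (CuspForm (Gamma1 N) k))
    (E : Module.End ℂ (CuspForm (Gamma1 N) k))
    (hEΛ : ∀ x ∈ integralLattice1 N k, E x ∈ integralLattice1 N k) (hEW : ∀ x, E x ∈ W)
    (hE : ∃ c : ℂ, c ≠ 0 ∧ ∀ w ∈ W, E w = c • w) :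
    ∃ (J₁ J₂ : Type) (_ : Fintype J₁) (_ : Fintype J₂) (_ : DecidableEq J₁) (_ : DecidableEq J₂)
      (B : Basis (J₁ ⊕ J₂) ℂ (CuspForm (Gamma1 N) k)),
      (∀ j, B j ∈ integralLattice1 N k) ∧
      (∀ x ∈ integralLattice1 N k, ∀ j, ∃ n : ℤ, B.repr x j = n) ∧
      (∀ j₁, B (Sum.inl j₁) ∈ W) ∧
      (∀ x ∈ W, ∀ j₂, B.repr x (Sum.inr j₂) = 0) := by
  classical
  have hspan : Submodule.span ℂ ((integralLattice1 N k : Submodule ℤ (CuspForm (Gamma1 N) k)) :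
      Set (CuspForm (Gamma1 N) k)) = ⊤ :=
    DeligneSerre1974_span_integralLattice1_holds N k hk
  -- `L ∩ W` as a submodule of `L`, saturated
  let ΛW : Submodule ℤ (integralLattice1 N k) :=
    (W.restrictScalars ℤ).comap (integralLattice1 N k).subtype
  have hΛW : ∀ y : integralLattice1 N k, y ∈ ΛW ↔ (y : CuspForm (Gamma1 N) k) ∈ W := fun y ↦ Iff.rfl
  have hsat : ∀ (a : ℤ) (y : integralLattice1 N k), a ≠ 0 → a • y ∈ ΛW → y ∈ ΛW := by
    intro a y ha h
    rw [hΛW] at h ⊢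
    have ha' : (a : ℂ) ≠ 0 := Int.cast_ne_zero.mpr ha
    have : (y : CuspForm (Gamma1 N) k) =
        (a : ℂ)⁻¹ • ((a • y : integralLattice1 N k) : CuspForm (Gamma1 N) k) := by
      rw [Submodule.coe_smul_of_tower, ← Int.cast_smul_eq_zsmul ℂ, smul_smul,
        inv_mul_cancel₀ ha', one_smul]
    rw [this]
    exact W.smul_mem _ h
  -- Smith normal form of `L ∩ W ≤ L`: a basis `bM` of `L` and non-zero integers `a i` with
  -- `a i • bM (f i)` a basis of `L ∩ W`; by saturation the `bM (f i)` lie in `L ∩ W`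
  obtain ⟨n₁, snf⟩ :=
    Submodule.smithNormalForm (Module.Free.chooseBasis ℤ (integralLattice1 N k)) ΛW
  let ι₀ := Module.Free.ChooseBasisIndex ℤ (integralLattice1 N k)
  have hfmem : ∀ i : Fin n₁, snf.bM (snf.f i) ∈ ΛW := by
    intro i
    have ha : snf.a i ≠ 0 := by
      intro h0
      have := snf.snf i
      rw [h0, zero_smul] at this
      exact snf.bN.ne_zero i (Subtype.ext this)
    refine hsat (snf.a i) _ ha ?_
    rw [← snf.snf i]
    exact (snf.bN i).2
  -- reindex `ι₀` as `Fin n₁ ⊕ J₂`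
  let J₂ : Type := ↥(Set.range snf.f)ᶜ
  let e : Fin n₁ ⊕ J₂ ≃ ι₀ :=
    (Equiv.sumCongr (Equiv.ofInjective _ snf.f.injective) (Equiv.refl J₂)).trans
      (Equiv.Set.sumCompl (Set.range snf.f))
  have he : ∀ i : Fin n₁, e (Sum.inl i) = snf.f i := fun i ↦ by
    simp only [e, Equiv.trans_apply, Equiv.sumCongr_apply, Sum.map_inl, Equiv.ofInjective_apply]
    rfl
  let bΛ : Basis (Fin n₁ ⊕ J₂) ℤ (integralLattice1 N k) := snf.bM.reindex e.symm
  have hbΛ : ∀ j, bΛ j = snf.bM (e j) := fun j ↦ by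
    rw [Basis.reindex_apply, Equiv.symm_symm]
  let v' : Fin n₁ ⊕ J₂ → (integralLattice1 N k) := fun j ↦ bΛ j
  have hli' : LinearIndependent ℤ v' := bΛ.linearIndependent
  -- the adapted family in `S_k(Γ₁(N))`: `ℂ`-independent and spanning
  let v : Fin n₁ ⊕ J₂ → CuspForm (Gamma1 N) k := fun j ↦ (v' j : CuspForm (Gamma1 N) k)
  have hvZ : LinearIndependent ℤ v :=
    hli'.map' (integralLattice1 N k).subtype (Submodule.ker_subtype _)
  have hli : LinearIndependent ℂ v :=
    LatticeEigen.linearIndependent_complex_of_rat_functionals hvZ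
      (fun n ↦ cuspCoeffₗ (k := k) (HeckeTGamma1.one_mem_strictPeriods_Gamma1 N) n)
      (fun n j ↦ exists_rat_cuspCoeffₗ_of_mem_integralLattice1 n (v' j).2)
      cuspForm_gamma1_eq_zero_of_forall_cuspCoeff
  -- every `x ∈ L` is the integer combination of the `v j` given by `bΛ`
  have hsum : ∀ x (hx : x ∈ integralLattice1 N k),
      ∑ j, ((bΛ.repr ⟨x, hx⟩ j : ℤ) : ℂ) • v j = x := by
    intro x hx
    have := congrArg ((integralLattice1 N k).subtype) (bΛ.sum_repr ⟨x, hx⟩)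
    simpa only [map_sum, map_smul, Submodule.subtype_apply, Int.cast_smul_eq_zsmul]
      using this
  have hsp : ⊤ ≤ Submodule.span ℂ (Set.range v) := by
    rw [← hspan, Submodule.span_le]
    intro x hx
    rw [SetLike.mem_coe, ← hsum x hx]
    exact Submodule.sum_mem _ fun j _ ↦
      Submodule.smul_mem _ _ (Submodule.subset_span (Set.mem_range_self j))
  let B : Basis (Fin n₁ ⊕ J₂) ℂ (CuspForm (Gamma1 N) k) := Basis.mk hli hsp
  have hB : ∀ j, B j = v j := fun j ↦ Basis.mk_apply hli hsp j
  have hBint : ∀ x ∈ integralLattice1 N k, ∀ j, ∃ n : ℤ, B.repr x j = n := by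
    intro x hx j
    refine ⟨bΛ.repr ⟨x, hx⟩ j, ?_⟩
    have h1 := B.repr_sum_self (fun j ↦ ((bΛ.repr ⟨x, hx⟩ j : ℤ) : ℂ))
    simp only [hB] at h1
    rw [hsum x hx] at h1
    exact congrFun h1 j
  -- elements of `L ∩ W` are integer combinations of the `v (inl i)`:
  -- `y = ∑ cᵢ bN i = ∑ cᵢ aᵢ bM (f i) = ∑ cᵢ aᵢ v (inl i)`
  have hvinl : ∀ i : Fin n₁,
      v (Sum.inl i) = ((snf.bM (snf.f i) : integralLattice1 N k) : CuspForm (Gamma1 N) k) := by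
    intro i
    show ((bΛ (Sum.inl i) : integralLattice1 N k) : CuspForm (Gamma1 N) k) = _
    rw [hbΛ, he]
  have hspanW : ∀ y : integralLattice1 N k, (y : CuspForm (Gamma1 N) k) ∈ W →
      (y : CuspForm (Gamma1 N) k) ∈ Submodule.span ℂ (Set.range (v ∘ Sum.inl)) := by
    intro y hy
    have hrepr := snf.bN.sum_repr ⟨y, (hΛW y).mpr hy⟩
    have hrepr' : (∑ i, ((snf.bN.repr ⟨y, (hΛW y).mpr hy⟩ i * snf.a i : ℤ) : ℂ) • v (Sum.inl i)) =
        (y : CuspForm (Gamma1 N) k) := by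
      have := congrArg ((integralLattice1 N k).subtype ∘ₗ ΛW.subtype) hrepr
      simp only [LinearMap.coe_comp, Function.comp_apply, map_sum, map_smul,
        Submodule.subtype_apply] at this
      refine Eq.trans (Finset.sum_congr rfl fun i _ ↦ ?_) this
      rw [Int.cast_smul_eq_zsmul ℂ, ← smul_smul]
      congr 1
      rw [hvinl, snf.snf i, Submodule.coe_smul_of_tower]
    rw [← hrepr']
    exact Submodule.sum_mem _ fun i _ ↦
      Submodule.smul_mem _ _ (Submodule.subset_span ⟨i, rfl⟩)
  haveI : Fintype J₂ := Fintype.ofFinite J₂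
  refine ⟨Fin n₁, J₂, inferInstance, inferInstance, inferInstance, inferInstance, B,
    fun j ↦ by rw [hB]; exact (v' j).2, hBint, fun j₁ ↦ ?_, ?_⟩
  · rw [hB, hvinl]
    exact (hΛW _).mp (hfmem j₁)
  -- `W ⊆ span (v ∘ inl)`: `x = c⁻¹ E x` and `E x ∈ span (E v) ⊆ span (v ∘ inl)`
  obtain ⟨c, hc0, hc⟩ := hE
  intro x hx j₂
  have hEx : E x ∈ Submodule.span ℂ (Set.range (v ∘ Sum.inl)) := by
    have : E x = ∑ j, B.repr x j • E (v j) := by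
      conv_lhs => rw [← B.sum_repr x]
      simp only [map_sum, map_smul, hB]
    rw [this]
    refine Submodule.sum_mem _ fun j _ ↦ Submodule.smul_mem _ _ ?_
    exact hspanW ⟨E (v j), hEΛ _ (v' j).2⟩ (hEW _)
  have hxspan : x ∈ Submodule.span ℂ (Set.range (v ∘ Sum.inl)) := by
    have : x = c⁻¹ • E x := by rw [hc x hx, smul_smul, inv_mul_cancel₀ hc0, one_smul]
    rw [this]
    exact Submodule.smul_mem _ _ hEx
  have hrange : Set.range (v ∘ Sum.inl) = B '' Set.range (Sum.inl : Fin n₁ → Fin n₁ ⊕ J₂) := by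
    ext y
    simp only [Set.mem_range, Function.comp_apply, Set.mem_image, exists_exists_eq_and, hB]
  rw [hrange, Basis.mem_span_image] at hxspan
  by_contra hne
  have : (Sum.inr j₂ : Fin n₁ ⊕ J₂) ∈ ((B.repr x).support : Set (Fin n₁ ⊕ J₂)) := by
    simpa [Finsupp.mem_support_iff] using hne
  obtain ⟨i, hi⟩ := hxspan this
  exact Sum.inl_ne_inr hi

end Adapted

/-! ### Diamond operators: powers, fixed spaces -/

section Diamond

variable {N : ℕ} [NeZero N] {k : ℤ}

/-- `⟨d^m⟩ = ⟨d⟩^m` for a unit `d` (Diamond–Shurman §5.2: `d ↦ ⟨d⟩` is a representation of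
`(ℤ/Nℤ)ˣ`; `diamondOp_mul_holds`). [cite: DiamondShurman2005, §5.2] -/
theorem diamondOp_units_pow (d : (ZMod N)ˣ) (m : ℕ) :
    diamondOp N k ((d ^ m : (ZMod N)ˣ) : ZMod N) = diamondOp N k (d : ZMod N) ^ m := by
  induction m with
  | zero =>
    rw [pow_zero, pow_zero, Units.val_one]
    exact LinearMap.ext fun f ↦ Literature.NumberTheory.Automorphic.ModularForms.diamondOp_one_apply f
  | succ m ih =>
    rw [pow_succ, pow_succ, Units.val_mul, diamondOp_mul_holds N k (d ^ m).isUnit d.isUnit, ih]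

/-- On `S_k(N, χ₀)` the diamond operators act through `χ₀`. [folklore] -/
theorem diamondOp_apply_of_mem_nebentypusSubspace {χ₀ : DirichletCharacter ℂ N}
    {f : CuspForm (Gamma1 N) k} (hf : f ∈ nebentypusSubspace N k χ₀) (d : (ZMod N)ˣ) :
    diamondOp N k (d : ZMod N) f = χ₀ (d : ZMod N) • f :=
  (mem_nebentypusSubspace_iff_diamondOp.mp hf) d

end Diamond

/-! ### `(γ, δ)` The lifting theorem -/

section Main

variable {p : ℕ} [Fact p.Prime] {N : ℕ} [NeZero N] {k : ℤ}

open scoped TensorProduct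

/-- For a vector with entries in the maximal ideal, `1 ⊗ v = 0` in `k ⊗ 𝒪ᴶ`. [folklore] -/
theorem one_tmul_eq_zero_of_forall_mem {𝒪 : Type*} [CommRing 𝒪] [IsLocalRing 𝒪] {J : Type*}
    [Fintype J] [DecidableEq J] (v : J → 𝒪) (hv : ∀ j, v j ∈ maximalIdeal 𝒪) :
    (1 : ResidueField 𝒪) ⊗ₜ[𝒪] v = 0 := by
  have hv' : v = ∑ j, v j • (Pi.single j 1 : J → 𝒪) := by
    ext i
    simp [Finset.sum_apply, Pi.single_apply]
  rw [hv', TensorProduct.tmul_sum]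
  refine Finset.sum_eq_zero fun j _ ↦ ?_
  rw [← TensorProduct.smul_tmul, Algebra.smul_def, mul_one, ResidueField.algebraMap_eq,
    (residue_eq_zero_iff _).mpr (hv j), TensorProduct.zero_tmul]

set_option maxHeartbeats 800000 in
/-- **Deligne–Serre lifting for cusp forms of a fixed nebentypus of ANY order, read through
`ι : ℚ̄_p ≃ ℂ` — the nebentypus of the lift is only CONGRUENT to `χ₀`.**  Same hypotheses as
`exists_eigenform_of_congruence` except that the order `m` of `χ₀` (`χ₀ ^ m = 1`, `m ≠ 0`) may be
divisible by `p`; same proof (steps `(α)`–`(γ)` of the module docstring, Deligne–Serre 1974, 6.10 and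
Lemme 6.11), with step `(δ)` stopped before its last line: the lift `g ≠ 0` is a common eigenform of
`𝒯` with eigenvalues congruent to the targets AND of every diamond operator `⟨d⟩`, with
`⟨d⟩ g = ι(c_d) g` for `m`-th roots of unity `c_d ∈ 𝒪_{ℚ̄_p}` CONGRUENT to `ι⁻¹ χ₀(d)` modulo the
maximal ideal (so `g` has a nebentypus `ψ ≡ χ₀ (mod 𝔪)`, `ψ ^ m = 1`; when `p ∤ m` the congruence
forces `ψ = χ₀`, which is `exists_eigenform_of_congruence`).  This is the form needed when `p`
divides the order of every character in play, e.g. `p = 2` and odd weight (`χ₀(-1) = -1`).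
[cite: DeligneSerreASENS1974, 6.10 and Lemme 6.11] -/
theorem exists_eigenform_of_congruence_nebentypus_congr (ι : PadicAlgCl p ≃+* ℂ) (hk : 1 ≤ k)
    {χ₀ : DirichletCharacter ℂ N} {m : ℕ} (hm0 : m ≠ 0) (hχm : χ₀ ^ m = 1)
    (𝒯 : Set (Module.End ℂ (CuspForm (Gamma1 N) k)))
    (hcomm : ∀ S ∈ 𝒯, ∀ T ∈ 𝒯, Commute S T)
    (hdiam : ∀ T ∈ 𝒯, ∀ d : (ZMod N)ˣ, Commute T (diamondOp N k (d : ZMod N)))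
    (hΛ : ∀ T ∈ 𝒯, ∀ x ∈ integralLattice1 N k, T x ∈ integralLattice1 N k)
    (a : Module.End ℂ (CuspForm (Gamma1 N) k) → PadicAlgCl p) (ha : ∀ T ∈ 𝒯, ‖a T‖ ≤ 1)
    {f₀ : CuspForm (Gamma1 N) k} (hf₀ : f₀ ∈ nebentypusSubspace N k χ₀)
    (hint : ∀ n, ‖ι.symm (cuspCoeff f₀ n)‖ ≤ 1) {n₀ : ℕ} (hunit : ‖ι.symm (cuspCoeff f₀ n₀)‖ = 1)
    (hcongr : ∀ T ∈ 𝒯, ∀ n,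
      ‖ι.symm (cuspCoeff (T f₀) n) - a T * ι.symm (cuspCoeff f₀ n)‖ < 1) :
    ∃ (g : CuspForm (Gamma1 N) k) (a' : Module.End ℂ (CuspForm (Gamma1 N) k) → PadicAlgCl p),
      g ≠ 0 ∧
      (∀ d : (ZMod N)ˣ, ∃ c : PadicAlgCl p, ‖c‖ ≤ 1 ∧ c ^ m = 1 ∧
        ‖c - ι.symm (χ₀ (d : ZMod N))‖ < 1 ∧ diamondOp N k (d : ZMod N) g = ι c • g) ∧
      ∀ T ∈ 𝒯, ‖a' T‖ ≤ 1 ∧ ‖a' T - a T‖ < 1 ∧ T g = ι (a' T) • g := by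
  classical
  -- ### the valuation ring `𝒪` of `ℚ̄_p`
  let O : ValuationSubring (PadicAlgCl p) := (Valued.v (R := PadicAlgCl p)).valuationSubring
  have hO : ∀ x : PadicAlgCl p, x ∈ O ↔ ‖x‖ ≤ 1 :=
    Literature.NumberTheory.GaloisRepresentations.padicAlgCl_mem_valuationSubring_iff p
  have hOm : ∀ x : O, x ∈ maximalIdeal O ↔ ‖(x : PadicAlgCl p)‖ < 1 :=
    Literature.NumberTheory.GaloisRepresentations.mem_maximalIdeal_iff_norm_lt_one hO
  -- ### `χ₀(d)` is an `m`-th root of unity, of norm one through `ι⁻¹`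
  have hχpow : ∀ d : (ZMod N)ˣ, χ₀ (d : ZMod N) ^ m = 1 := fun d ↦ by
    rw [← MulChar.pow_apply_coe, hχm, MulChar.one_apply_coe]
  have hχnorm : ∀ d : (ZMod N)ˣ, ‖ι.symm (χ₀ (d : ZMod N))‖ = 1 := fun d ↦ by
    have h1 : ‖ι.symm (χ₀ (d : ZMod N))‖ ^ m = 1 := by
      rw [← norm_pow, ← map_pow, hχpow, map_one, norm_one]
    exact (pow_eq_one_iff_of_nonneg (norm_nonneg _) hm0).1 h1
  -- ### `f₀`: diamond action, non-vanishing, `p`-integrality of all twisted coefficients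
  have hf₀d : ∀ d : (ZMod N)ˣ, diamondOp N k (d : ZMod N) f₀ = χ₀ (d : ZMod N) • f₀ :=
    diamondOp_apply_of_mem_nebentypusSubspace hf₀
  have hf₀ne : f₀ ≠ 0 := by
    intro h0
    rw [h0] at hunit
    have : cuspCoeff (0 : CuspForm (Gamma1 N) k) n₀ = 0 := by
      have := map_zero (cuspCoeffₗ (k := k) (HeckeTGamma1.one_mem_strictPeriods_Gamma1 N) n₀)
      simpa only [cuspCoeffₗ_apply] using this
    rw [this, map_zero, norm_zero] at hunit
    exact zero_ne_one hunit
  have hf₀twist : ∀ (d : (ZMod N)ˣ) (n : ℕ),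
      ‖ι.symm (cuspCoeff (diamondOp N k (d : ZMod N) f₀) n)‖ ≤ 1 := fun d n ↦ by
    rw [hf₀d, cuspCoeff_smul_gamma1, map_mul, norm_mul, hχnorm, one_mul]
    exact hint n
  -- ### `(β)` the fixed space `W` of the `⟨d^m⟩` and the quasi-projector `E = ∑_d ⟨d^m⟩`
  let Dm : (ZMod N)ˣ → Module.End ℂ (CuspForm (Gamma1 N) k) :=
    fun d ↦ diamondOp N k ((d ^ m : (ZMod N)ˣ) : ZMod N)
  let W : Submodule ℂ (CuspForm (Gamma1 N) k) := ⨅ d : (ZMod N)ˣ, LinearMap.ker (Dm d - 1)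
  have hW : ∀ x, x ∈ W ↔ ∀ d : (ZMod N)ˣ, Dm d x = x := fun x ↦ by
    simp only [W, Submodule.mem_iInf, LinearMap.mem_ker, LinearMap.sub_apply,
      Module.End.one_apply, sub_eq_zero]
  let E : Module.End ℂ (CuspForm (Gamma1 N) k) := ∑ d : (ZMod N)ˣ, Dm d
  have hDm_mul : ∀ d e : (ZMod N)ˣ, Dm e * Dm d = Dm (e * d) := fun d e ↦ by
    simp only [Dm]
    rw [mul_pow, Units.val_mul, diamondOp_mul_holds N k (e ^ m).isUnit (d ^ m).isUnit]
  have hEΛ : ∀ x ∈ integralLattice1 N k, E x ∈ integralLattice1 N k := fun x hx ↦ by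
    simp only [E, LinearMap.sum_apply]
    exact Submodule.sum_mem _ fun d _ ↦ diamondOp_mem_integralLattice1 hx _
  have hEW : ∀ x, E x ∈ W := fun x ↦ by
    rw [hW]
    intro e
    simp only [E, LinearMap.sum_apply, map_sum]
    have : ∀ d, Dm e (Dm d x) = Dm (e * d) x := fun d ↦ by
      rw [← Module.End.mul_apply, hDm_mul]
    simp only [this]
    exact Fintype.sum_equiv (Equiv.mulLeft e) _ _ fun d ↦ rfl
  have hE : ∃ c : ℂ, c ≠ 0 ∧ ∀ w ∈ W, E w = c • w := by
    refine ⟨Fintype.card (ZMod N)ˣ, Nat.cast_ne_zero.mpr Fintype.card_ne_zero, fun w hw ↦ ?_⟩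
    rw [hW] at hw
    simp only [E, LinearMap.sum_apply, hw, Finset.sum_const, Finset.card_univ, Nat.cast_smul_eq_nsmul]
  have hf₀W : f₀ ∈ W := by
    rw [hW]
    intro d
    simp only [Dm]
    rw [hf₀d (d ^ m), Units.val_pow_eq_pow_val, map_pow, hχpow d, one_smul]
  -- the enlarged family `𝒯' = 𝒯 ∪ {⟨d⟩}`: its members preserve `L` and `W` and commute
  let 𝒯' : Set (Module.End ℂ (CuspForm (Gamma1 N) k)) :=
    𝒯 ∪ Set.range fun d : (ZMod N)ˣ ↦ diamondOp N k (d : ZMod N)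
  have h𝒯'diam : ∀ T ∈ 𝒯', ∀ d : (ZMod N)ˣ, Commute T (diamondOp N k (d : ZMod N)) := by
    rintro T (hT | ⟨e, rfl⟩) d
    · exact hdiam T hT d
    · exact diamondOp_comm N k _ _
  have h𝒯'comm : ∀ S ∈ 𝒯', ∀ T ∈ 𝒯', Commute S T := by
    rintro S hS T (hT | ⟨d, rfl⟩)
    · rcases hS with hS | ⟨e, rfl⟩
      · exact hcomm S hS T hT
      · exact (hdiam T hT e).symm
    · exact h𝒯'diam S hS d
  have h𝒯'Λ : ∀ T ∈ 𝒯', ∀ x ∈ integralLattice1 N k, T x ∈ integralLattice1 N k := by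
    rintro T (hT | ⟨d, rfl⟩) x hx
    · exact hΛ T hT x hx
    · exact diamondOp_mem_integralLattice1 hx d
  have h𝒯'W : ∀ T ∈ 𝒯', ∀ x ∈ W, T x ∈ W := fun T hT x hx ↦ by
    rw [hW] at hx ⊢
    intro d
    have hc : Commute T (Dm d) := h𝒯'diam T hT (d ^ m)
    rw [← Module.End.mul_apply, ← hc.eq, Module.End.mul_apply, hx d]
  -- targets for the enlarged family: `a_T` on `𝒯`, the true eigenvalue `χ₀(d)` on the `⟨d⟩`
  let tK : Module.End ℂ (CuspForm (Gamma1 N) k) → PadicAlgCl p :=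
    fun T ↦ if T ∈ 𝒯 then a T else ι.symm (LatticeEigen.eigenvalueOf f₀ T)
  have htKdiam : ∀ d : (ZMod N)ˣ,
      ‖tK (diamondOp N k (d : ZMod N)) - ι.symm (χ₀ (d : ZMod N))‖ < 1 := fun d ↦ by
    by_cases hd : diamondOp N k (d : ZMod N) ∈ 𝒯
    · simp only [tK, if_pos hd]
      have h1 := hcongr _ hd n₀
      rw [hf₀d, cuspCoeff_smul_gamma1, map_mul, ← sub_mul, norm_mul, hunit, mul_one] at h1
      rwa [← norm_neg, neg_sub] at h1
    · simp only [tK, if_neg hd]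
      rw [LatticeEigen.eigenvalueOf_eq hf₀ne (hf₀d d), sub_self, norm_zero]
      exact one_pos
  have htKnorm : ∀ T ∈ 𝒯', ‖tK T‖ ≤ 1 := by
    intro T hT
    by_cases hTm : T ∈ 𝒯
    · simp only [tK, if_pos hTm]; exact ha T hTm
    · rcases hT with hT | ⟨d, rfl⟩
      · exact absurd hT hTm
      · have h1 := htKdiam d
        have h2 : tK (diamondOp N k (d : ZMod N)) =
            (tK (diamondOp N k (d : ZMod N)) - ι.symm (χ₀ (d : ZMod N))) + ι.symm (χ₀ (d : ZMod N)) := by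
          ring
        rw [h2]
        refine (PadicAlgCl.isNonarchimedean p _ _).trans (max_le h1.le (hχnorm d).le)
  have htKcongr : ∀ T ∈ 𝒯', ∀ n,
      ‖ι.symm (cuspCoeff (T f₀) n) - tK T * ι.symm (cuspCoeff f₀ n)‖ < 1 := by
    intro T hT n
    by_cases hTm : T ∈ 𝒯
    · simp only [tK, if_pos hTm]; exact hcongr T hTm n
    · rcases hT with hT | ⟨d, rfl⟩
      · exact absurd hT hTm
      · simp only [tK, if_neg hTm]
        rw [LatticeEigen.eigenvalueOf_eq hf₀ne (hf₀d d), hf₀d, cuspCoeff_smul_gamma1, map_mul,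
          sub_self, norm_zero]
        exact one_pos
  -- ### the adapted basis
  obtain ⟨J₁, J₂, _, _, _, _, B, hBΛ, hBint, hBW, hBrepr⟩ := exists_adapted_basis hk W E hEΛ hEW hE
  -- `x ∈ W` is the combination of the `B (inl j)` alone
  have hsumW : ∀ x ∈ W, ∑ j : J₁, B.repr x (Sum.inl j) • B (Sum.inl j) = x := fun x hx ↦ by
    conv_rhs => rw [← B.sum_repr x, Fintype.sum_sum_type]
    simp [hBrepr x hx]
  -- ### `(γ)` matrices of the operators on `W` in the basis `B ∘ inl`
  let MatC : Module.End ℂ (CuspForm (Gamma1 N) k) → Matrix J₁ J₁ ℂ :=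
    fun T ↦ Matrix.of fun i j ↦ B.repr (T (B (Sum.inl j))) (Sum.inl i)
  -- coordinates of `T x`, `x ∈ W`
  have hMatC : ∀ T ∈ 𝒯', ∀ x ∈ W, ∀ i,
      B.repr (T x) (Sum.inl i) = ∑ j, MatC T i j * B.repr x (Sum.inl j) := by
    intro T hT x hx i
    conv_lhs => rw [← hsumW x hx]
    simp only [map_sum, map_smul, Finsupp.coe_finsetSum, Finsupp.coe_smul, Finset.sum_apply,
      Pi.smul_apply, smul_eq_mul, MatC, Matrix.of_apply]
    exact Finset.sum_congr rfl fun j _ ↦ mul_comm _ _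
  -- the entries are integers
  have hMatCint : ∀ T ∈ 𝒯', ∀ i j, ∃ z : ℤ, MatC T i j = z := fun T hT i j ↦ by
    obtain ⟨z, hz⟩ := hBint _ (h𝒯'Λ T hT _ (hBΛ _)) (Sum.inl i)
    exact ⟨z, hz⟩
  have hMatCnorm : ∀ T ∈ 𝒯', ∀ i j, ‖ι.symm (MatC T i j)‖ ≤ 1 := fun T hT i j ↦ by
    obtain ⟨z, hz⟩ := hMatCint T hT i j
    rw [hz, map_intCast]
    exact norm_intCast_le_one z
  -- matrices over `𝒪`
  let MatO : Module.End ℂ (CuspForm (Gamma1 N) k) → Matrix J₁ J₁ O :=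
    fun T ↦ Matrix.of fun i j ↦
      if h : ‖ι.symm (MatC T i j)‖ ≤ 1 then ⟨ι.symm (MatC T i j), (hO _).mpr h⟩ else 0
  have hMatO : ∀ T ∈ 𝒯', ∀ i j, ((MatO T i j : O) : PadicAlgCl p) = ι.symm (MatC T i j) :=
      fun T hT i j ↦ by
    simp only [MatO, Matrix.of_apply, dif_pos (hMatCnorm T hT i j)]
  have hMatOC : ∀ T ∈ 𝒯', ∀ i j, ι ((MatO T i j : O) : PadicAlgCl p) = MatC T i j :=
      fun T hT i j ↦ by
    rw [hMatO T hT, RingEquiv.apply_symm_apply]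
  -- products: `MatC (S T) = MatC S * MatC T` on `𝒯'`, hence the `MatO` commute
  have hMatCmul : ∀ S ∈ 𝒯', ∀ T ∈ 𝒯', MatC (S * T) = MatC S * MatC T := by
    intro S hS T hT
    ext i j
    simp only [Matrix.mul_apply]
    change B.repr (S (T (B (Sum.inl j)))) (Sum.inl i) = _
    rw [hMatC S hS _ (h𝒯'W T hT _ (hBW j)) i]
    rfl
  let φ : O →+* ℂ := ι.toRingHom.comp O.subtype
  have hφ : ∀ x : O, φ x = ι (x : PadicAlgCl p) := fun x ↦ rfl
  have hφinj : Function.Injective φ := ι.injective.comp Subtype.val_injective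
  have hMatOmap : ∀ T ∈ 𝒯', (MatO T).map φ = MatC T := fun T hT ↦ by
    ext i j
    rw [Matrix.map_apply, hφ, hMatOC T hT]
  have hMatOcomm : ∀ S ∈ 𝒯', ∀ T ∈ 𝒯', MatO S * MatO T = MatO T * MatO S := by
    intro S hS T hT
    apply Matrix.map_injective hφinj
    change (MatO S * MatO T).map φ = (MatO T * MatO S).map φ
    rw [Matrix.map_mul, Matrix.map_mul, hMatOmap S hS, hMatOmap T hT, ← hMatCmul S hS T hT,
      ← hMatCmul T hT S hS, (h𝒯'comm S hS T hT).eq]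
  -- ### the coordinate vector `c₀` of `f₀` (supported on `J₁`), with a unit coordinate
  have hc₀norm : ∀ j, ‖ι.symm (B.repr f₀ (Sum.inl j))‖ ≤ 1 := fun j ↦
    norm_repr_le ι B hBΛ hBint f₀ zero_le_one hf₀twist (Sum.inl j)
  let c₀ : J₁ → O := fun j ↦ ⟨ι.symm (B.repr f₀ (Sum.inl j)), (hO _).mpr (hc₀norm j)⟩
  have hc₀ : ∀ j, ((c₀ j : O) : PadicAlgCl p) = ι.symm (B.repr f₀ (Sum.inl j)) := fun j ↦ rfl
  have hunitcoord : ∃ j₀, ‖((c₀ j₀ : O) : PadicAlgCl p)‖ = 1 := by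
    by_contra hall
    push Not at hall
    have hlt : ∀ j, ‖ι.symm (B.repr f₀ (Sum.inl j))‖ < 1 := fun j ↦
      lt_of_le_of_ne (hc₀norm j) (hall j)
    have hexp : cuspCoeff f₀ n₀ = ∑ j, B.repr f₀ (Sum.inl j) * cuspCoeff (B (Sum.inl j)) n₀ := by
      conv_lhs => rw [← hsumW f₀ hf₀W]
      rw [cuspCoeff_sum_gamma1]
      exact Finset.sum_congr rfl fun j _ ↦ by rw [cuspCoeff_smul_gamma1]
    have hint' : ∀ j, ‖ι.symm (cuspCoeff (B (Sum.inl j)) n₀)‖ ≤ 1 := fun j ↦ by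
      obtain ⟨z, hz⟩ := exists_int_eq_cuspCoeff_of_mem_integralLattice1 (hBΛ (Sum.inl j)) n₀
      rw [← hz, map_intCast]; exact norm_intCast_le_one z
    have hlt1 : ‖ι.symm (cuspCoeff f₀ n₀)‖ < 1 := by
      rw [hexp, map_sum]
      rcases (Finset.univ : Finset J₁).eq_empty_or_nonempty with hJ | hJ
      · rw [hJ, Finset.sum_empty, norm_zero]; exact one_pos
      · obtain ⟨j, -, hj⟩ := IsUltrametricDist.exists_norm_finsetSum_le_of_nonempty hJ
          (fun j ↦ ι.symm (B.repr f₀ (Sum.inl j) * cuspCoeff (B (Sum.inl j)) n₀))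
        refine hj.trans_lt ?_
        rw [map_mul, norm_mul]
        calc ‖ι.symm (B.repr f₀ (Sum.inl j))‖ * ‖ι.symm (cuspCoeff (B (Sum.inl j)) n₀)‖
            ≤ ‖ι.symm (B.repr f₀ (Sum.inl j))‖ * 1 := by gcongr; exact hint' j
          _ < 1 := by rw [mul_one]; exact hlt j
    rw [hunit] at hlt1
    exact lt_irrefl _ hlt1
  obtain ⟨j₀, hj₀⟩ := hunitcoord
  have hj₀m : c₀ j₀ ∉ maximalIdeal O := fun h ↦ by
    rw [hOm, hj₀] at h; exact lt_irrefl _ h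
  have hj₀unit : IsUnit (c₀ j₀) := by
    by_contra hnu
    exact hj₀m ((IsLocalRing.mem_maximalIdeal _).mpr hnu)
  set u : Oˣ := hj₀unit.unit with hu
  have huval : (u : O) = c₀ j₀ := hj₀unit.unit_spec
  have hunorm : ‖((u : O) : PadicAlgCl p)‖ = 1 := by rw [huval, hj₀]
  have huinvnorm : ‖(((u⁻¹ : Oˣ) : O) : PadicAlgCl p)‖ = 1 := by
    have h1 : ((u : O) : PadicAlgCl p) * (((u⁻¹ : Oˣ) : O) : PadicAlgCl p) = 1 := by
      rw [← MulMemClass.coe_mul, ← Units.val_mul, mul_inv_cancel, Units.val_one, OneMemClass.coe_one]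
    have h2 := congrArg norm h1
    rw [norm_mul, hunorm, one_mul, norm_one] at h2
    exact h2
  -- ### targets in `𝒪` and the congruences in coordinates
  let tO : Module.End ℂ (CuspForm (Gamma1 N) k) → O :=
    fun T ↦ if h : ‖tK T‖ ≤ 1 then ⟨tK T, (hO _).mpr h⟩ else 0
  have htO : ∀ T ∈ 𝒯', ((tO T : O) : PadicAlgCl p) = tK T := fun T hT ↦ by
    simp only [tO, dif_pos (htKnorm T hT)]
  have hcoe : ∀ z : O, (z : PadicAlgCl p) = algebraMap O (PadicAlgCl p) z := fun z ↦ rfl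
  have hmulVec : ∀ T ∈ 𝒯', ∀ i, ((((MatO T).mulVec c₀) i : O) : PadicAlgCl p) =
      ι.symm (∑ j, MatC T i j * B.repr f₀ (Sum.inl j)) := by
    intro T hT i
    rw [hcoe, Matrix.mulVec, dotProduct, map_sum, map_sum]
    refine Finset.sum_congr rfl fun j _ ↦ ?_
    rw [map_mul, map_mul, ← hcoe, ← hcoe, hMatO T hT, hc₀]
  have hcoord : ∀ T ∈ 𝒯', ∀ i,
      ‖((((MatO T).mulVec c₀) i : O) : PadicAlgCl p) - tK T * (c₀ i : PadicAlgCl p)‖ < 1 := by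
    intro T hT i
    -- the vector `y = T f₀ - ι(tK T) • f₀` has all twisted coefficients in `𝔪`
    set y := T f₀ - ι (tK T) • f₀ with hy
    have hytwist : ∀ (d : (ZMod N)ˣ) (n : ℕ),
        ‖ι.symm (cuspCoeff (diamondOp N k (d : ZMod N) y) n)‖ < 1 := by
      intro d n
      have h1 : diamondOp N k (d : ZMod N) y = χ₀ (d : ZMod N) • (T f₀ - ι (tK T) • f₀) := by
        rw [hy, map_sub, map_smul, ← Module.End.mul_apply, ← (h𝒯'diam T hT d).eq,
          Module.End.mul_apply, hf₀d, map_smul, smul_sub, smul_comm]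
      rw [h1, cuspCoeff_smul_gamma1, map_mul, norm_mul, hχnorm, one_mul, cuspCoeff_sub_gamma1,
        cuspCoeff_smul_gamma1, map_sub, map_mul, RingEquiv.symm_apply_apply]
      exact htKcongr T hT n
    have hyi := norm_repr_lt ι B hBΛ hBint y hytwist (Sum.inl i)
    have hyrepr : B.repr y (Sum.inl i) =
        ∑ j, MatC T i j * B.repr f₀ (Sum.inl j) - ι (tK T) * B.repr f₀ (Sum.inl i) := by
      rw [hy, map_sub, map_smul, Finsupp.sub_apply, Finsupp.smul_apply, smul_eq_mul,
        hMatC T hT f₀ hf₀W i]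
    rw [hyrepr, map_sub, map_mul, RingEquiv.symm_apply_apply] at hyi
    rwa [hmulVec T hT i, hc₀]
  -- ### `(γ)` the Deligne–Serre data over `𝒪`: `M = 𝒪^{J₁}`, matrix operators, `f = 1 ⊗ c₀`
  let Top : Module.End ℂ (CuspForm (Gamma1 N) k) → Module.End O (J₁ → O) :=
    fun T ↦ Matrix.toLin' (MatO T)
  have hTop : ∀ T v, Top T v = (MatO T).mulVec v := fun T v ↦ Matrix.toLin'_apply _ _
  let 𝒯M : Set (Module.End O (J₁ → O)) := Top '' 𝒯'
  have h𝒯Mcomm : ∀ S ∈ 𝒯M, ∀ T ∈ 𝒯M, Commute S T := by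
    rintro _ ⟨S, hS, rfl⟩ _ ⟨T, hT, rfl⟩
    change Matrix.toLin' (MatO S) * Matrix.toLin' (MatO T) =
      Matrix.toLin' (MatO T) * Matrix.toLin' (MatO S)
    rw [Module.End.mul_eq_comp, Module.End.mul_eq_comp, ← Matrix.toLin'_mul, ← Matrix.toLin'_mul,
      hMatOcomm S hS T hT]
  -- the canonical lift `t(Th) = (Th c₀)_{j₀} / (c₀)_{j₀}` of the residual eigenvalue
  let tM : Module.End O (J₁ → O) → O := fun Th ↦ Th c₀ j₀ * ((u⁻¹ : Oˣ) : O)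
  have htM : ∀ T ∈ 𝒯', ‖((tM (Top T) : O) : PadicAlgCl p) - tK T‖ < 1 := by
    intro T hT
    have h1 := hcoord T hT j₀
    have h2 : ((tM (Top T) : O) : PadicAlgCl p) - tK T =
        (((((MatO T).mulVec c₀) j₀ : O) : PadicAlgCl p) - tK T * (c₀ j₀ : PadicAlgCl p)) *
          ((((u⁻¹ : Oˣ) : O) : PadicAlgCl p)) := by
      have hcu : (c₀ j₀ : PadicAlgCl p) * (((u⁻¹ : Oˣ) : O) : PadicAlgCl p) = 1 := by
        rw [← huval, ← MulMemClass.coe_mul, ← Units.val_mul, mul_inv_cancel, Units.val_one,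
          OneMemClass.coe_one]
      simp only [tM, hTop, MulMemClass.coe_mul]
      rw [sub_mul, mul_assoc, hcu, mul_one]
    rw [h2, norm_mul, huinvnorm, mul_one]
    exact h1
  -- all entries of `MatO T *ᵥ c₀ - t • c₀` lie in `𝔪`
  have hentries : ∀ T ∈ 𝒯', ∀ i,
      ((MatO T).mulVec c₀ i - tM (Top T) * c₀ i : O) ∈ maximalIdeal O := by
    intro T hT i
    rw [hOm, AddSubgroupClass.coe_sub, MulMemClass.coe_mul]
    have hsplit : ((((MatO T).mulVec c₀) i : O) : PadicAlgCl p) -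
        (tM (Top T) : PadicAlgCl p) * (c₀ i : PadicAlgCl p) =
        (((((MatO T).mulVec c₀) i : O) : PadicAlgCl p) - tK T * (c₀ i : PadicAlgCl p)) +
          (tK T - ((tM (Top T) : O) : PadicAlgCl p)) * (c₀ i : PadicAlgCl p) := by ring
    rw [hsplit]
    refine (PadicAlgCl.isNonarchimedean p _ _).trans_lt (max_lt (hcoord T hT i) ?_)
    rw [norm_mul, norm_sub_rev]
    calc ‖((tM (Top T) : O) : PadicAlgCl p) - tK T‖ * ‖(c₀ i : PadicAlgCl p)‖
        ≤ ‖((tM (Top T) : O) : PadicAlgCl p) - tK T‖ * 1 := by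
          gcongr; rw [hc₀]; exact hc₀norm i
      _ < 1 := by rw [mul_one]; exact htM T hT
  -- the residual eigenvalues and the eigenvector `f = 1 ⊗ c₀` modulo `𝔪`
  let aM : Module.End O (J₁ → O) → ResidueField O := fun Th ↦ residue O (tM Th)
  have hsmul_tmul : ∀ (r : O) (v : J₁ → O),
      residue O r • ((1 : ResidueField O) ⊗ₜ[O] v) = (1 : ResidueField O) ⊗ₜ[O] (r • v) := by
    intro r v
    have h1 : (residue O r : ResidueField O) = r • (1 : ResidueField O) := by
      rw [Algebra.smul_def, mul_one, ResidueField.algebraMap_eq]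
    rw [TensorProduct.smul_tmul', smul_eq_mul, mul_one, h1, TensorProduct.smul_tmul]
  have heig : ∀ Th ∈ 𝒯M, Th.baseChange (ResidueField O) ((1 : ResidueField O) ⊗ₜ[O] c₀) =
      aM Th • ((1 : ResidueField O) ⊗ₜ[O] c₀) := by
    rintro _ ⟨T, hT, rfl⟩
    rw [LinearMap.baseChange_tmul, hsmul_tmul, ← sub_eq_zero, ← TensorProduct.tmul_sub]
    refine one_tmul_eq_zero_of_forall_mem _ fun i ↦ ?_
    rw [Pi.sub_apply, Pi.smul_apply, smul_eq_mul, hTop]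
    exact hentries T hT i
  have hf : ((1 : ResidueField O) ⊗ₜ[O] c₀ : ResidueField O ⊗[O] (J₁ → O)) ≠ 0 := by
    intro h0
    let ψ : ResidueField O ⊗[O] (J₁ → O) →ₗ[O] ResidueField O :=
      (TensorProduct.rid O (ResidueField O)).toLinearMap ∘ₗ
        (LinearMap.lTensor (ResidueField O) (LinearMap.proj j₀ : (J₁ → O) →ₗ[O] O))
    have h1 : ψ ((1 : ResidueField O) ⊗ₜ[O] c₀) = residue O (c₀ j₀) := by
      simp only [ψ, LinearMap.coe_comp, Function.comp_apply, LinearMap.lTensor_tmul,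
        LinearMap.coe_proj, Function.eval, LinearEquiv.coe_coe, TensorProduct.rid_tmul]
      rw [Algebra.smul_def, mul_one, ResidueField.algebraMap_eq]
    rw [h0, map_zero] at h1
    exact hj₀m ((residue_eq_zero_iff _).mp h1.symm)
  -- ### Deligne–Serre, Lemme 6.11 over the valuation ring of `ℚ̄_p`
  obtain ⟨a', g, hg0, hgeig, hres⟩ :=
    Literature.RingTheory.Valuation.exists_eigenvalue_lift_of_isAlgClosed (K := PadicAlgCl p)
      𝒯M h𝒯Mcomm aM hf heig
  -- ### transport of the eigenvector back to `S_k(Γ₁(N))`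
  -- coordinates of `g` in the basis `1 ⊗ eⱼ` of `ℚ̄_p ⊗ 𝒪^{J₁}`
  let bK : Basis J₁ (PadicAlgCl p) (PadicAlgCl p ⊗[O] (J₁ → O)) :=
    Algebra.TensorProduct.basis (PadicAlgCl p) (Pi.basisFun O J₁)
  have hbK : ∀ j, bK j = (1 : PadicAlgCl p) ⊗ₜ[O] (Pi.single j 1 : J₁ → O) := fun j ↦ by
    rw [Algebra.TensorProduct.basis_apply, Pi.basisFun_apply]
  let gc : J₁ → PadicAlgCl p := fun j ↦ bK.repr g j
  have hgsum : g = ∑ j, gc j • bK j := (bK.sum_repr g).symm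
  -- the matrix action on the basis vectors
  have hcol : ∀ T j, (1 : PadicAlgCl p) ⊗ₜ[O] ((MatO T).mulVec (Pi.single j 1)) =
      ∑ i, ((MatO T i j : O) : PadicAlgCl p) • bK i := by
    intro T j
    rw [Matrix.mulVec_single_one]
    have h1 : ((MatO T).col j : J₁ → O) = ∑ i, (MatO T i j) • (Pi.single i 1 : J₁ → O) := by
      ext i'
      simp [Finset.sum_apply, Pi.single_apply, Matrix.col_apply]
    rw [h1, TensorProduct.tmul_sum]
    refine Finset.sum_congr rfl fun i _ ↦ ?_
    rw [hbK, TensorProduct.smul_tmul', smul_eq_mul, mul_one]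
    rw [← TensorProduct.smul_tmul, Algebra.smul_def, mul_one, ← hcoe]
  -- the eigen-equations in coordinates
  have hE1 : ∀ T ∈ 𝒯', ∀ i, ∑ j, ((MatO T i j : O) : PadicAlgCl p) * gc j =
      ((a' (Top T) : O) : PadicAlgCl p) * gc i := by
    intro T hT i
    have hg := hgeig (Top T) ⟨T, hT, rfl⟩
    set cL : J₁ → PadicAlgCl p := fun i ↦ ∑ j, ((MatO T i j : O) : PadicAlgCl p) * gc j with hcL
    set cR : J₁ → PadicAlgCl p := fun i ↦ ((a' (Top T) : O) : PadicAlgCl p) * gc i with hcR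
    have hL : (Top T).baseChange (PadicAlgCl p) g = ∑ i, cL i • bK i := by
      have h1 : ∀ j, (Top T).baseChange (PadicAlgCl p) (bK j) =
          ∑ i, ((MatO T i j : O) : PadicAlgCl p) • bK i := fun j ↦ by
        rw [hbK, LinearMap.baseChange_tmul, hTop, hcol]
      rw [hgsum, map_sum]
      simp only [map_smul, h1, Finset.smul_sum, smul_smul]
      rw [Finset.sum_comm]
      refine Finset.sum_congr rfl fun i _ ↦ ?_
      rw [hcL, Finset.sum_smul]
      exact Finset.sum_congr rfl fun j _ ↦ by rw [mul_comm]
    have hR : algebraMap O (PadicAlgCl p) (a' (Top T)) • g = ∑ i, cR i • bK i := by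
      rw [hgsum, Finset.smul_sum]
      exact Finset.sum_congr rfl fun i _ ↦ by rw [smul_smul, ← hcoe]
    rw [hL, hR] at hg
    calc cL i = bK.repr (∑ i, cL i • bK i) i := (congrFun (bK.repr_sum_self cL) i).symm
      _ = bK.repr (∑ i, cR i • bK i) i := by rw [hg]
      _ = cR i := congrFun (bK.repr_sum_self cR) i
  have hgc : ∃ j, gc j ≠ 0 := by
    by_contra hall
    push Not at hall
    apply hg0
    rw [hgsum]
    exact Finset.sum_eq_zero fun j _ ↦ by rw [hall j, zero_smul]
  -- the cusp form `g_S = ∑ⱼ ι(gⱼ) B (inl j) ∈ W`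
  let gS : CuspForm (Gamma1 N) k := ∑ j, ι (gc j) • B (Sum.inl j)
  have hgSW : gS ∈ W := Submodule.sum_mem _ fun j _ ↦ Submodule.smul_mem _ _ (hBW j)
  have hgSrepr : ∀ j, B.repr gS (Sum.inl j) = ι (gc j) := by
    intro j
    have h1 : gS = ∑ l : J₁ ⊕ J₂, Sum.elim (fun j ↦ ι (gc j)) (fun _ ↦ (0 : ℂ)) l • B l := by
      rw [Fintype.sum_sum_type]
      simp [gS]
    have h2 := congrFun (B.repr_sum_self (Sum.elim (fun j ↦ ι (gc j)) (fun _ ↦ (0 : ℂ)))) (Sum.inl j)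
    rw [← h1] at h2
    simpa using h2
  have hgS0 : gS ≠ 0 := by
    intro h0
    obtain ⟨j, hj⟩ := hgc
    have h1 := hgSrepr j
    rw [h0, map_zero, Finsupp.zero_apply] at h1
    exact hj (ι.injective (by rw [map_zero]; exact h1.symm))
  have hgSeig : ∀ T ∈ 𝒯', T gS = ι ((a' (Top T) : O) : PadicAlgCl p) • gS := by
    intro T hT
    have hTB : ∀ j, T (B (Sum.inl j)) = ∑ i, MatC T i j • B (Sum.inl i) := fun j ↦
      (hsumW _ (h𝒯'W T hT _ (hBW j))).symm
    simp only [gS, map_sum, map_smul, hTB, Finset.smul_sum, smul_smul]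
    rw [Finset.sum_comm]
    refine Finset.sum_congr rfl fun i _ ↦ ?_
    rw [← Finset.sum_smul]
    congr 1
    calc ∑ j, ι (gc j) * MatC T i j = ι (∑ j, ((MatO T i j : O) : PadicAlgCl p) * gc j) := by
          rw [map_sum]
          exact Finset.sum_congr rfl fun j _ ↦ by rw [map_mul, hMatOC T hT, mul_comm]
      _ = ι ((a' (Top T) : O) : PadicAlgCl p) * ι (gc i) := by rw [hE1 T hT i, map_mul]
  -- ### the lifted eigenvalues are congruent to the targets
  have hres' : ∀ T ∈ 𝒯', ‖((a' (Top T) : O) : PadicAlgCl p) - tK T‖ < 1 := by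
    intro T hT
    have h1 : residue O (a' (Top T)) = residue O (tM (Top T)) := hres (Top T) ⟨T, hT, rfl⟩
    have h2 : a' (Top T) - tM (Top T) ∈ maximalIdeal O := Ideal.Quotient.eq.mp h1
    rw [hOm, AddSubgroupClass.coe_sub] at h2
    have h3 : ((a' (Top T) : O) : PadicAlgCl p) - tK T =
        (((a' (Top T) : O) : PadicAlgCl p) - (tM (Top T) : PadicAlgCl p)) +
          (((tM (Top T) : O) : PadicAlgCl p) - tK T) := by ring
    rw [h3]
    exact (PadicAlgCl.isNonarchimedean p _ _).trans_lt (max_lt h2 (htM T hT))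
  -- ### `(δ)` the nebentypus of the lift
  have hpow_apply : ∀ (T : Module.End ℂ (CuspForm (Gamma1 N) k)) (c : ℂ)
      (x : CuspForm (Gamma1 N) k),
      T x = c • x → ∀ n : ℕ, (T ^ n) x = c ^ n • x := by
    intro T c x h n
    induction n with
    | zero => simp
    | succ n ih =>
      rw [pow_succ, Module.End.mul_apply, h, map_smul, ih, smul_smul, pow_succ, mul_comm]
  have hgStype : ∀ d : (ZMod N)ˣ, ∃ c : PadicAlgCl p, ‖c‖ ≤ 1 ∧ c ^ m = 1 ∧
      ‖c - ι.symm (χ₀ (d : ZMod N))‖ < 1 ∧ diamondOp N k (d : ZMod N) gS = ι c • gS := by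
    intro d
    have hd : diamondOp N k (d : ZMod N) ∈ 𝒯' := Or.inr ⟨d, rfl⟩
    set α : PadicAlgCl p := ((a' (Top (diamondOp N k (d : ZMod N))) : O) : PadicAlgCl p) with hα
    have heig := hgSeig _ hd
    -- `α^m = 1`: `g_S ∈ W` is fixed by `⟨d^m⟩ = ⟨d⟩^m`
    have hfix : (diamondOp N k (d : ZMod N) ^ m) gS = gS := by
      rw [← diamondOp_units_pow]
      exact (hW gS).mp hgSW d
    rw [hpow_apply _ _ _ heig m] at hfix
    have hαm : ι α ^ m = 1 := by
      have h1 : (ι α ^ m - 1) • gS = 0 := by rw [sub_smul, one_smul, hfix, sub_self]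
      exact sub_eq_zero.mp ((smul_eq_zero.mp h1).resolve_right hgS0)
    have hαm' : α ^ m = 1 := by
      have := congrArg ι.symm hαm
      rwa [map_pow, RingEquiv.symm_apply_apply, map_one] at this
    have hcongr' : ‖α - ι.symm (χ₀ (d : ZMod N))‖ < 1 := by
      have h1 := hres' _ hd
      have h2 := htKdiam d
      have h3 : α - ι.symm (χ₀ (d : ZMod N)) = (α - tK (diamondOp N k (d : ZMod N))) +
          (tK (diamondOp N k (d : ZMod N)) - ι.symm (χ₀ (d : ZMod N))) := by ring
      rw [h3]
      exact (PadicAlgCl.isNonarchimedean p _ _).trans_lt (max_lt h1 h2)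
    exact ⟨α, (hO _).mp (a' _).2, hαm', hcongr', heig⟩
  -- ### conclusion
  refine ⟨gS, fun T ↦ ((a' (Top T) : O) : PadicAlgCl p), hgS0, hgStype, fun T hT ↦ ⟨?_, ?_, ?_⟩⟩
  · exact (hO _).mp (a' (Top T)).2
  · have h1 := hres' T (Or.inl hT)
    simp only [tK, if_pos hT] at h1
    exact h1
  · exact hgSeig T (Or.inl hT)

/-- **Deligne–Serre lifting for cusp forms of a fixed nebentypus of order prime to `p`, read
through `ι : ℚ̄_p ≃ ℂ`.**  See the module docstring for the statement and the proof.  Hypotheses: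
`ι : ℚ̄_p ≃ ℂ`; `k ≥ 1`; `χ₀` a Dirichlet character modulo `N` with `χ₀^m = 1`, `p ∤ m`; `𝒯` a set of
pairwise commuting endomorphisms of `S_k(Γ₁(N))` commuting with all diamond operators `⟨d⟩`,
`d ∈ (ℤ/Nℤ)ˣ`, and preserving `L = integralLattice1 N k`; targets `a_T ∈ ℚ̄_p` with `‖a_T‖ ≤ 1`;
`f₀ ∈ S_k(N, χ₀)` with `‖ι⁻¹ aₙ(f₀)‖ ≤ 1` for all `n`, `= 1` for some `n₀`, and
`‖ι⁻¹ aₙ(T f₀) - a_T ι⁻¹ aₙ(f₀)‖ < 1` for all `T ∈ 𝒯` and `n`.  Conclusion: a non-zero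
`g ∈ S_k(N, χ₀)` and `a'_T ∈ ℚ̄_p`, `‖a'_T‖ ≤ 1`, `‖a'_T - a_T‖ < 1`, with `T g = ι(a'_T) g` for every
`T ∈ 𝒯` (Deligne–Serre 1974, 6.10–6.11, in the form used by Billerey–Menares 2016, proof of
Thm. 2.2, and 2018, §3.2). [cite: DeligneSerreASENS1974, 6.10 and Lemme 6.11]
[cite: BillereyMenares2016, §2, proof of Thm. 2.2 (p. 7)] -/
theorem exists_eigenform_of_congruence (ι : PadicAlgCl p ≃+* ℂ) (hk : 1 ≤ k)
    {χ₀ : DirichletCharacter ℂ N} {m : ℕ} (hm : ¬ p ∣ m) (hχm : χ₀ ^ m = 1)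
    (𝒯 : Set (Module.End ℂ (CuspForm (Gamma1 N) k)))
    (hcomm : ∀ S ∈ 𝒯, ∀ T ∈ 𝒯, Commute S T)
    (hdiam : ∀ T ∈ 𝒯, ∀ d : (ZMod N)ˣ, Commute T (diamondOp N k (d : ZMod N)))
    (hΛ : ∀ T ∈ 𝒯, ∀ x ∈ integralLattice1 N k, T x ∈ integralLattice1 N k)
    (a : Module.End ℂ (CuspForm (Gamma1 N) k) → PadicAlgCl p) (ha : ∀ T ∈ 𝒯, ‖a T‖ ≤ 1)
    {f₀ : CuspForm (Gamma1 N) k} (hf₀ : f₀ ∈ nebentypusSubspace N k χ₀)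
    (hint : ∀ n, ‖ι.symm (cuspCoeff f₀ n)‖ ≤ 1) {n₀ : ℕ} (hunit : ‖ι.symm (cuspCoeff f₀ n₀)‖ = 1)
    (hcongr : ∀ T ∈ 𝒯, ∀ n,
      ‖ι.symm (cuspCoeff (T f₀) n) - a T * ι.symm (cuspCoeff f₀ n)‖ < 1) :
    ∃ (g : CuspForm (Gamma1 N) k) (a' : Module.End ℂ (CuspForm (Gamma1 N) k) → PadicAlgCl p),
      g ≠ 0 ∧ g ∈ nebentypusSubspace N k χ₀ ∧
      ∀ T ∈ 𝒯, ‖a' T‖ ≤ 1 ∧ ‖a' T - a T‖ < 1 ∧ T g = ι (a' T) • g := by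
  have hm0 : m ≠ 0 := fun h0 ↦ hm (h0 ▸ dvd_zero p)
  obtain ⟨g, a', hg0, hdiamond, hT⟩ := exists_eigenform_of_congruence_nebentypus_congr ι hk hm0 hχm
    𝒯 hcomm hdiam hΛ a ha hf₀ hint hunit hcongr
  refine ⟨g, a', hg0, mem_nebentypusSubspace_iff_diamondOp.mpr (fun d ↦ ?_), hT⟩
  obtain ⟨c, -, hcm, hcongr', hdg⟩ := hdiamond d
  have hχpow : χ₀ (d : ZMod N) ^ m = 1 := by
    rw [← MulChar.pow_apply_coe, hχm, MulChar.one_apply_coe]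
  have hχm' : (ι.symm (χ₀ (d : ZMod N))) ^ m = 1 := by rw [← map_pow, hχpow, map_one]
  have hceq : c = ι.symm (χ₀ (d : ZMod N)) :=
    Literature.NumberTheory.GaloisRepresentations.eq_of_pow_eq_one_of_norm_sub_lt_one
      (Nat.pos_of_ne_zero hm0) hm hcm hχm' hcongr'
  rw [hdg, hceq, RingEquiv.apply_symm_apply]

end Main

end DeligneSerreLift

end Literature.NumberTheory.EllipticCurves.ModularForms
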